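import Mathlib
import HarnessLib
import Summits.Langlands.Langlands.Theses.SkinnerWilesDefectOne
import Summits.Langlands.Langlands.Theorems.SkinnerWilesDefectOneReducibleOrdinaryProModularDefs
import Literature.NumberTheory.GaloisRepresentations.NearlyOrdinaryDeformationRing
import Literature.NumberTheory.GaloisRepresentations.NearlyOrdinaryDeformationRingProofs
import Literature.NumberTheory.GaloisRepresentations.AbsolutelyIrreducibleReduction
import Literature.NumberTheory.GaloisRepresentations.PadicIntermediateFieldIntegers
import Summits.Langlands.Langlands.Theorems.SkinnerWilesDefectOneReducibleOrdinaryProModularOrientedSteinbergDatumEndLatticeAux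
import Summits.Langlands.Langlands.Theorems.SkinnerWilesDefectOneReducibleOrdinaryProModularOrientedSteinbergDatumAlgebraAux

/-! # The Skinner–Wiles oriented residual datum `𝒟` over `𝒪_E`: helper file `…OrientedSteinbergDatumDatumAux`
for stub `stub_orientedSteinbergDatum` of line steinberg-hyperplane (crux ReducibleOrdinaryProModular,
stmt-Langlands-12919)

Descent of the oriented end lattice `T ρ T⁻¹` (`stub_orientedSteinbergDatum_auxEndLattice`) to a homomorphism
`ρ_E : Γ_F → GL₂(𝒪_E)`, `𝒪_E` the valuation ring of the finite extension `E/ℚ_p` (a complete DVR with finite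
residue field `k_E`), and construction of the residual datum `𝒟 = (S, ρ̄_E, oriented frames)` of the tree's
`NearlyOrdinaryDatum` together with everything `ModelData.Models` asks of it: `ρ̄_E` upper triangular with the
ordered residual diagonal of `ρ₀` (through `k_E → k_O`), scalar centralizer (non-split + distinguished,
Berger–Klosin Lemma 28 in matrix form: `hasScalarCentralizer_of_nonsplit` of `…AlgebraAux`), `p`-distinguished, ORIENTED frames
`(x_v 1; 1 0)` at `v ∣ p`, and `ρ_E` a deformation of type `𝒟` to `(𝒪_E, 𝒪_E → k_E)` (`𝔪`-adically
continuous, unramified outside `S ⊇ S♯`, nearly ordinary in the oriented frames).  REGISTERED statement: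
`stub_orientedSteinbergDatum_auxDatum`.

References: Skinner–Wiles, Publ. Math. IHÉS 89 (1999), §2.1, §4.6; Calegari–Mazur, J. Inst. Math. Jussieu 8
(2009), §2.1–2.2; Berger–Klosin, Math. Ann. 355 (2013), Lemma 28.
-/

set_option linter.dupNamespace false
set_option autoImplicit false

namespace Summit.Langlands.Langlands.Cruxes.ReducibleOrdinaryProModular.SteinbergHyperplane

open scoped NumberField MatrixGroups
open Filter NumberField IsDedekindDomain Field Polynomial Matrix IsLocalRing
open Literature.NumberTheory.Automorphic Literature.NumberTheory.Automorphic.BigHeckeGLn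
open Literature.NumberTheory.GaloisRepresentations
open Summit.Langlands.Langlands.Theses.SkinnerWilesDefectOne

noncomputable section

namespace OrientedDatum

variable {p : ℕ} [Fact p.Prime]

/-! ### The datum over an abstract normed coefficient ring -/

/-- Residues in `O = {‖x‖ ≤ 1} ⊆ ℚ̄_p` agree iff the difference has norm `< 1`. [folklore] -/
theorem residue_eq_residue_iff_norm {O : ValuationSubring (PadicAlgCl p)}
    (hO' : ∀ x : PadicAlgCl p, x ∈ O ↔ ‖x‖ ≤ 1) (y z : O) :
    residue O y = residue O z ↔ ‖(y : PadicAlgCl p) - (z : PadicAlgCl p)‖ < 1 := by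
  rw [← sub_eq_zero, ← map_sub, residue_eq_zero_iff, mem_maximalIdeal_iff_norm_lt_one hO']
  rfl

/-- **The oriented residual datum over an abstract coefficient ring `𝒪' ↪ ℚ̄_p`** whose maximal ideal and its
powers are cut out by the norm (intended: `𝒪' = 𝒪_E`): descent of the end lattice `T ρ T⁻¹` to
`ρ_E : Γ_F → GL₂(𝒪')`, the datum `𝒟 = (S, ρ̄_E, (x_v 1; 1 0)_v)` and all its `ModelData.Models` properties.
[cite: SkinnerWiles1999, §2.1] -/
theorem datum_core {𝒪' : Type} [CommRing 𝒪'] [IsLocalRing 𝒪'] (emb : 𝒪' →+* PadicAlgCl p)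
    (hemb_inj : Function.Injective emb) (E : IntermediateField ℚ_[p] (PadicAlgCl p))
    (hrange : ∀ x : PadicAlgCl p, x ∈ E → ‖x‖ ≤ 1 → ∃ y : 𝒪', emb y = x)
    (hEmem : ∀ y : 𝒪', emb y ∈ E ∧ ‖emb y‖ ≤ 1)
    (hmax : ∀ y : 𝒪', y ∈ maximalIdeal 𝒪' ↔ ‖emb y‖ < 1) (r : ℝ) (hr : 0 < r)
    (hpow : ∀ (m : ℕ) (y : 𝒪'), y ∈ maximalIdeal 𝒪' ^ m ↔ ‖emb y‖ ≤ r ^ m)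
    {F : Type} [Field F] [NumberField F] {O : ValuationSubring (PadicAlgCl p)}
    (hO' : ∀ x : PadicAlgCl p, x ∈ O ↔ ‖x‖ ≤ 1)
    (ρ : FramedGaloisRep F (PadicAlgCl p) 2) (ρ₀ : absoluteGaloisGroup F →* GL (Fin 2) O)
    (hmap : ∀ g, Matrix.GeneralLinearGroup.map O.subtype (ρ₀ g) = ρ g) (T : GL (Fin 2) (PadicAlgCl p))
    (hTint : ∀ g i j, (T * ρ g * T⁻¹).val i j ∈ E ∧ ‖(T * ρ g * T⁻¹).val i j‖ ≤ 1)
    (hT10 : ∀ g, ‖(T * ρ g * T⁻¹).val 1 0‖ < 1)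
    (hTdiag : ∀ g (i : Fin 2), ‖(T * ρ g * T⁻¹).val i i - (ρ g).val i i‖ < 1)
    (hTns : ∀ x : PadicAlgCl p, x ∈ E → ‖x‖ ≤ 1 →
      ∃ g, 1 ≤ ‖(T * ρ g * T⁻¹).val 0 1 - x * ((T * ρ g * T⁻¹).val 1 1 - (T * ρ g * T⁻¹).val 0 0)‖)
    (hTdist : ∃ g, 1 ≤ ‖(ρ g).val 0 0 - (ρ g).val 1 1‖)
    (hTloc : ∀ v : HeightOneSpectrum (𝓞 F), (p : 𝓞 F) ∈ v.asIdeal → ∃ x : PadicAlgCl p, x ∈ E ∧ ‖x‖ ≤ 1 ∧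
      (∀ σ, (T * ρ.toLocal v σ * T⁻¹).val 0 0 * x + (T * ρ.toLocal v σ * T⁻¹).val 0 1 =
        x * ((T * ρ.toLocal v σ * T⁻¹).val 1 0 * x + (T * ρ.toLocal v σ * T⁻¹).val 1 1)) ∧
      ∃ σ, 1 ≤ ‖((T * ρ.toLocal v σ * T⁻¹).val 1 0 * x + (T * ρ.toLocal v σ * T⁻¹).val 1 1) -
        ((T * ρ.toLocal v σ * T⁻¹).val 0 0 - x * (T * ρ.toLocal v σ * T⁻¹).val 1 0)‖)
    (S : Set (HeightOneSpectrum (𝓞 F))) (hS : S.Finite) (hSb : baseLevel ρ ⊆ S) :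
    ∃ (𝒟 : NearlyOrdinaryDatum F p 𝒪' (ResidueField 𝒪')) (ρE : absoluteGaloisGroup F →* GL (Fin 2) 𝒪'),
      𝒟.S = S ∧ (∀ g, (𝒟.residual g).val 1 0 = 0) ∧
      (∃ ι : ResidueField 𝒪' →+* ResidueField O,
        ∀ g (i : Fin 2), ι ((𝒟.residual g).val i i) = residue O ((ρ₀ g).val i i)) ∧
      𝒟.HasScalarCentralizer ∧
      (∀ v : HeightOneSpectrum (𝓞 F), (p : 𝓞 F) ∈ v.asIdeal → 𝒟.IsDistinguishedAt v) ∧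
      (∀ v : HeightOneSpectrum (𝓞 F), (p : 𝓞 F) ∈ v.asIdeal → (𝒟.frame v).val 1 0 ≠ 0) ∧
      𝒟.IsDeformation (Algebra.ofId 𝒪' (ResidueField 𝒪')) ρE ∧
      ∀ g, Matrix.GeneralLinearGroup.map emb (ρE g) = T * ρ g * T⁻¹ := by
  classical
  have hent₀ : ∀ g i j, (ρ g).val i j = (((ρ₀ g).val i j : O) : PadicAlgCl p) := fun g i j =>
    FramedRep.coe_apply_eq_of_map_eq (hmap g) i j
  have hres0 : ∀ y : 𝒪', algebraMap 𝒪' (ResidueField 𝒪') y = 0 ↔ ‖emb y‖ < 1 := fun y => by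
    rw [IsLocalRing.ResidueField.algebraMap_eq, residue_eq_zero_iff, hmax]
  have hres_eq : ∀ y z : 𝒪', algebraMap 𝒪' (ResidueField 𝒪') y = algebraMap 𝒪' (ResidueField 𝒪') z ↔
      ‖emb y - emb z‖ < 1 := fun y z => by
    rw [← sub_eq_zero, ← map_sub (algebraMap 𝒪' (ResidueField 𝒪')), hres0, map_sub emb]
  have hofId : ((Algebra.ofId 𝒪' (ResidueField 𝒪') : 𝒪' →ₐ[𝒪'] ResidueField 𝒪') : 𝒪' →+* ResidueField 𝒪') =
      algebraMap 𝒪' (ResidueField 𝒪') := RingHom.ext fun _ => rfl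
  have hsurjk : Function.Surjective (algebraMap 𝒪' (ResidueField 𝒪')) := by
    rw [IsLocalRing.ResidueField.algebraMap_eq]; exact IsLocalRing.residue_surjective
  -- descent of `T ρ T⁻¹` to `ρE : Γ_F → GL₂(𝒪')`
  obtain ⟨ρE, hρE⟩ := exists_hom_of_forall_mem_range emb hemb_inj
    ((MulAut.conj T).toMonoidHom.comp ρ.toMonoidHom) fun g i j => by
      obtain ⟨y, hy⟩ := hrange _ (hTint g i j).1 (hTint g i j).2
      exact ⟨y, hy⟩
  have hρE' : ∀ g, Matrix.GeneralLinearGroup.map emb (ρE g) = T * ρ g * T⁻¹ := fun g => (hρE g).trans rfl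
  have hent : ∀ g i j, emb ((ρE g).val i j) = (T * ρ g * T⁻¹).val i j := fun g i j => by
    rw [← Matrix.GeneralLinearGroup.map_apply, hρE']
  have hρE_one : ∀ σ, ρ σ = 1 → ρE σ = 1 := fun σ hσ => by
    apply Deformation.generalLinearGroup_map_injective emb hemb_inj
    rw [hρE', hσ, mul_one, mul_inv_cancel, map_one]
  have hcont : ∀ i j, Continuous fun g => (T * ρ g * T⁻¹).val i j := fun i j =>
    (Units.continuous_val.comp ((continuous_const.mul (map_continuous ρ)).mul continuous_const)).matrix_elem i j
  -- the residual representation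
  set resGL : GL (Fin 2) 𝒪' →* GL (Fin 2) (ResidueField 𝒪') :=
    Matrix.GeneralLinearGroup.map (algebraMap 𝒪' (ResidueField 𝒪')) with hresGL
  set rbar : absoluteGaloisGroup F →* GL (Fin 2) (ResidueField 𝒪') := resGL.comp ρE with hrbar
  have hrbar_apply : ∀ g i j, (rbar g).val i j = algebraMap 𝒪' (ResidueField 𝒪') ((ρE g).val i j) :=
    fun g i j => Matrix.GeneralLinearGroup.map_apply _ i j _
  -- the oriented frames at `v ∣ p`
  choose xv hxvE hxv1 hxeig hxdist using hTloc
  have hxR : ∀ v (hv : (p : 𝓞 F) ∈ v.asIdeal), ∃ y : 𝒪', emb y = xv v hv := fun v hv =>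
    hrange _ (hxvE v hv) (hxv1 v hv)
  choose xR hxR' using hxR
  have hPv := fun v (hv : (p : 𝓞 F) ∈ v.asIdeal) => exists_frameGL (xR v hv)
  choose Pv hPval hPconj using hPv
  have hReig : ∀ v (hv : (p : 𝓞 F) ∈ v.asIdeal) (σ : absoluteGaloisGroup (v.adicCompletion F)),
      ((Pv v hv)⁻¹ * ρE (absGaloisRestrict F (v.adicCompletion F) σ) * Pv v hv).val 1 0 = 0 := by
    intro v hv σ
    rw [Units.val_mul, Units.val_mul, (hPconj v hv _).2.2.1]
    apply hemb_inj
    rw [map_zero, map_sub, map_add, map_mul, map_mul, map_add, map_mul, hxR', hent, hent, hent, hent]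
    have := hxeig v hv σ
    rw [FramedGaloisRep.toLocal_apply] at this
    rw [this, sub_self]
  have hRdist : ∀ v (hv : (p : 𝓞 F) ∈ v.asIdeal), ∃ σ : absoluteGaloisGroup (v.adicCompletion F),
      algebraMap 𝒪' (ResidueField 𝒪')
          (((Pv v hv)⁻¹ * ρE (absGaloisRestrict F (v.adicCompletion F) σ) * Pv v hv).val 0 0) ≠
        algebraMap 𝒪' (ResidueField 𝒪')
          (((Pv v hv)⁻¹ * ρE (absGaloisRestrict F (v.adicCompletion F) σ) * Pv v hv).val 1 1) := by
    intro v hv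
    obtain ⟨σ, hσ⟩ := hxdist v hv
    refine ⟨σ, fun h => ?_⟩
    rw [hres_eq, Units.val_mul, Units.val_mul, (hPconj v hv _).1, (hPconj v hv _).2.2.2, map_add, map_mul,
      map_sub, map_mul, hxR', hent, hent, hent] at h
    rw [FramedGaloisRep.toLocal_apply] at hσ
    exact absurd h (not_lt.2 hσ)
  -- the datum
  let 𝒟 : NearlyOrdinaryDatum F p 𝒪' (ResidueField 𝒪') :=
    { residueMap_surjective := hsurjk
      S := S
      S_finite := hS
      mem_S_of_mem := fun v hv => hSb (Or.inl hv)
      residual := rbar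
      isOpen_ker_residual :=
        isOpen_ker_map_comp emb (algebraMap 𝒪' (ResidueField 𝒪')) (Metric.ball 0 1) Metric.isOpen_ball
          (fun y => by rw [hres0, Metric.mem_ball, dist_zero_right]) ρE (fun g => (T * ρ g * T⁻¹).val)
          hcont hent
      residual_unramified := fun v hv 𝔓 h𝔓 σ hσ => by
        have hunr : ρ.IsUnramifiedAt v := by
          by_contra h
          exact hv (hSb (Or.inr h))
        change resGL (ρE σ) = 1
        rw [hρE_one σ (hunr 𝔓 h𝔓 σ hσ), map_one]
      frame := fun v => if hv : (p : 𝓞 F) ∈ v.asIdeal then resGL (Pv v hv) else 1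
      frame_spec := fun v hv σ => by
        rw [dif_pos hv]
        change ((resGL (Pv v hv))⁻¹ * resGL (ρE _) * resGL (Pv v hv)).val 1 0 = 0
        rw [← map_inv, ← map_mul, ← map_mul, hresGL, Matrix.GeneralLinearGroup.map_apply, hReig, map_zero] }
  have hframe : ∀ v (hv : (p : 𝓞 F) ∈ v.asIdeal), 𝒟.frame v = resGL (Pv v hv) := fun v hv => dif_pos hv
  -- `k' → k_O`
  have hmemO : ∀ y : 𝒪', emb y ∈ O := fun y => (hO' _).2 (hEmem y).2
  let fO : 𝒪' →+* O :=
    { toFun := fun y => ⟨emb y, hmemO y⟩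
      map_one' := Subtype.ext (map_one emb)
      map_mul' := fun a b => Subtype.ext (map_mul emb a b)
      map_zero' := Subtype.ext (map_zero emb)
      map_add' := fun a b => Subtype.ext (map_add emb a b) }
  have hfO : ∀ y : 𝒪', ((fO y : O) : PadicAlgCl p) = emb y := fun y => rfl
  haveI : IsLocalHom fO := by
    refine ⟨fun y hy => ?_⟩
    by_contra hyu
    have hym : y ∈ maximalIdeal 𝒪' := hyu
    rw [hmax] at hym
    have : fO y ∈ maximalIdeal O := (mem_maximalIdeal_iff_norm_lt_one hO' _).2 hym
    exact this hy
  refine ⟨𝒟, ρE, rfl, fun g => ?_, ⟨ResidueField.map fO, fun g i => ?_⟩, ?_, fun v hv => ?_, fun v hv => ?_, ?_, hρE'⟩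
  · -- upper triangular
    change (rbar g).val 1 0 = 0
    rw [hrbar_apply, hres0, hent]
    exact hT10 g
  · -- same ordered residual diagonal
    change ResidueField.map fO ((rbar g).val i i) = _
    rw [hrbar_apply, IsLocalRing.ResidueField.algebraMap_eq, ResidueField.map_residue,
      residue_eq_residue_iff_norm hO', hfO, hent, ← hent₀]
    exact hTdiag g i
  · -- scalar centralizer
    intro M hM
    refine hasScalarCentralizer_of_nonsplit (fun γ => (rbar γ).val) (fun g => ?_) ?_ (fun x => ?_) M hM
    · rw [hrbar_apply, hres0, hent]; exact hT10 g
    · obtain ⟨g, hg⟩ := hTdist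
      refine ⟨g, fun h => ?_⟩
      rw [hrbar_apply, hrbar_apply, hres_eq, hent, hent] at h
      have h1 : 1 ≤ ‖(T * ρ g * T⁻¹).val 0 0 - (T * ρ g * T⁻¹).val 1 1‖ := by
        have he : (T * ρ g * T⁻¹).val 0 0 - (T * ρ g * T⁻¹).val 1 1 = ((ρ g).val 0 0 - (ρ g).val 1 1) +
            (((T * ρ g * T⁻¹).val 0 0 - (ρ g).val 0 0) - ((T * ρ g * T⁻¹).val 1 1 - (ρ g).val 1 1)) := by ring
        rw [he]
        exact one_le_norm_add_of_lt' hg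
          ((norm_sub_le_max' _ _).trans_lt (max_lt (hTdiag g 0) (hTdiag g 1)))
      exact absurd h (not_lt.2 h1)
    · obtain ⟨y, rfl⟩ := hsurjk x
      obtain ⟨g, hg⟩ := hTns (emb y) (hEmem y).1 (hEmem y).2
      refine ⟨g, fun h => ?_⟩
      rw [hrbar_apply, hrbar_apply, hrbar_apply, ← map_sub (algebraMap 𝒪' (ResidueField 𝒪')),
        ← map_mul (algebraMap 𝒪' (ResidueField 𝒪')), hres_eq, map_mul emb, map_sub emb, hent, hent, hent] at h
      exact absurd h (not_lt.2 hg)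
  · -- distinguished at `v ∣ p`
    obtain ⟨σ, hσ⟩ := hRdist v hv
    refine ⟨σ, ?_⟩
    rw [hframe v hv]
    change ((resGL (Pv v hv))⁻¹ * resGL (ρE _) * resGL (Pv v hv)).val 0 0 ≠
      ((resGL (Pv v hv))⁻¹ * resGL (ρE _) * resGL (Pv v hv)).val 1 1
    rw [← map_inv, ← map_mul, ← map_mul, hresGL, Matrix.GeneralLinearGroup.map_apply,
      Matrix.GeneralLinearGroup.map_apply]
    exact hσ
  · -- oriented
    rw [hframe v hv, hresGL, Matrix.GeneralLinearGroup.map_apply, hPval]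
    simp
  · -- `ρE` is a deformation of type `𝒟` to `(𝒪', 𝒪' → k')`
    refine ⟨⟨fun m => ?_, ?_, fun v hv 𝔓 h𝔓 σ hσ => ?_⟩, fun v hv => ⟨Pv v hv, ?_, hReig v hv⟩⟩
    · refine isOpen_ker_map_comp emb (Ideal.Quotient.mk (maximalIdeal 𝒪' ^ m)) (Metric.closedBall 0 (r ^ m))
        (IsUltrametricDist.isOpen_closedBall 0 (pow_ne_zero _ hr.ne')) (fun y => ?_) ρE
        (fun g => (T * ρ g * T⁻¹).val) hcont hent
      rw [Ideal.Quotient.eq_zero_iff_mem, hpow, Metric.mem_closedBall, dist_zero_right]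
    · change (Matrix.GeneralLinearGroup.map
        ((Algebra.ofId 𝒪' (ResidueField 𝒪') : 𝒪' →ₐ[𝒪'] ResidueField 𝒪') : 𝒪' →+* ResidueField 𝒪')).comp ρE = rbar
      rw [hofId]
    · have hunr : ρ.IsUnramifiedAt v := by
        by_contra h
        exact hv (hSb (Or.inr h))
      exact hρE_one σ (hunr 𝔓 h𝔓 σ hσ)
    · rw [hframe v hv, hofId]
      change ((resGL (Pv v hv))⁻¹ * resGL (Pv v hv)).val 1 0 = 0
      rw [inv_mul_cancel, Units.val_one, Matrix.one_apply_ne (by decide)]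

/-! ### The datum over `𝒪_E` -/

/-- **The oriented residual datum over `𝒪_E`** (all of `ModelData.Models` except the universal ring), for a
finite `E/ℚ_p` given by `stub_orientedSteinbergDatum_auxEndLattice`. [cite: SkinnerWiles1999, §2.1] -/
theorem datum_exists {F : Type} [Field F] [NumberField F] {O : ValuationSubring (PadicAlgCl p)}
    (hO : O = (Valued.v : Valuation (PadicAlgCl p) NNReal).valuationSubring)
    (ρ : FramedGaloisRep F (PadicAlgCl p) 2) (ρ₀ : absoluteGaloisGroup F →* GL (Fin 2) O)
    (hirr : ρ.toGaloisRep.IsIrreducible) (hint : ρ.HasUpperTriangularIntegralModel ρ₀)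
    (hloc : OrdLoc p O ρ ρ₀) (S : Set (HeightOneSpectrum (𝓞 F))) (hS : S.Finite) (hSb : baseLevel ρ ⊆ S) :
    ∃ (E : IntermediateField ℚ_[p] (PadicAlgCl p)) (_ : FiniteDimensional ℚ_[p] E)
      (𝒟 : NearlyOrdinaryDatum F p (intermediateFieldIntegers p E) (ResidueField (intermediateFieldIntegers p E)))
      (ρE : absoluteGaloisGroup F →* GL (Fin 2) (intermediateFieldIntegers p E)) (T : GL (Fin 2) (PadicAlgCl p)),
      𝒟.S = S ∧ (∀ g, (𝒟.residual g).val 1 0 = 0) ∧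
      (∃ ι : ResidueField (intermediateFieldIntegers p E) →+* ResidueField O,
        ∀ g (i : Fin 2), ι ((𝒟.residual g).val i i) = residue O ((ρ₀ g).val i i)) ∧
      𝒟.HasScalarCentralizer ∧
      (∀ v : HeightOneSpectrum (𝓞 F), (p : 𝓞 F) ∈ v.asIdeal → 𝒟.IsDistinguishedAt v) ∧
      (∀ v : HeightOneSpectrum (𝓞 F), (p : 𝓞 F) ∈ v.asIdeal → (𝒟.frame v).val 1 0 ≠ 0) ∧
      𝒟.IsDeformation (Algebra.ofId (intermediateFieldIntegers p E) (ResidueField (intermediateFieldIntegers p E))) ρE ∧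
      ∀ g, Matrix.GeneralLinearGroup.map ((algebraMap E (PadicAlgCl p)).comp (intermediateFieldIntegers p E).subtype)
        (ρE g) = T * ρ g * T⁻¹ := by
  have hO' : ∀ x : PadicAlgCl p, x ∈ O ↔ ‖x‖ ≤ 1 := fun x => by
    rw [hO]; exact padicAlgCl_mem_valuationSubring_iff p x
  obtain ⟨hmap, -⟩ := (FramedRep.hasUpperTriangularIntegralModel_two_iff _ ρ₀).1 hint
  obtain ⟨E, hEfin, T, hTint, hT10, hTdiag, hTns, hTdist, hTloc⟩ := endLattice_exists hO ρ ρ₀ hirr hint hloc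
  haveI := hEfin
  obtain ⟨𝒟, ρE, h⟩ := datum_core ((algebraMap E (PadicAlgCl p)).comp (intermediateFieldIntegers p E).subtype)
    (fun y z h => Subtype.ext (Subtype.ext h)) E
    (fun x hxE hx1 => ⟨⟨⟨x, hxE⟩, (intermediateFieldIntegers.mem_iff_norm_le_one E _).2 hx1⟩, rfl⟩)
    (fun y => ⟨(y : E).2, intermediateFieldIntegers.norm_le_one E y⟩)
    (fun y => intermediateFieldIntegers.mem_maximalIdeal_iff E y)
    ‖(intermediateFieldIntegers.uniformizer E : E)‖ (intermediateFieldIntegers.norm_uniformizer_pos E)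
    (fun m y => intermediateFieldIntegers.mem_maximalIdeal_pow_iff E m y)
    hO' ρ ρ₀ hmap T hTint hT10 hTdiag hTns hTdist hTloc S hS hSb
  exact ⟨E, hEfin, 𝒟, ρE, T, h⟩

end OrientedDatum

/-- **Registered sub-goal of `stub_orientedSteinbergDatum` (auxiliary file III): the oriented residual datum
over `𝒪_E`** (= `OrientedDatum.datum_exists` with explicit binders). [cite: SkinnerWiles1999, §2.1] -/
theorem stub_orientedSteinbergDatum_auxDatum :
    ∀ (F : Type) [Field F] [NumberField F] (p : ℕ) [Fact p.Prime] (O : ValuationSubring (PadicAlgCl p)), O = (Valued.v : Valuation (PadicAlgCl p) NNReal).valuationSubring → ∀ (ρ : FramedGaloisRep F (PadicAlgCl p) 2) (ρ₀ : absoluteGaloisGroup F →* GL (Fin 2) O), ρ.toGaloisRep.IsIrreducible → ρ.HasUpperTriangularIntegralModel ρ₀ → OrdLoc p O ρ ρ₀ → ∀ (S : Set (HeightOneSpectrum (𝓞 F))), S.Finite → baseLevel ρ ⊆ S → ∃ (E : IntermediateField ℚ_[p] (PadicAlgCl p)) (_ : FiniteDimensional ℚ_[p] E) (𝒟 : NearlyOrdinaryDatum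 F p (intermediateFieldIntegers p E) (IsLocalRing.ResidueField (intermediateFieldIntegers p E))) (ρE : absoluteGaloisGroup F →* GL (Fin 2) (intermediateFieldIntegers p E)) (T : GL (Fin 2) (PadicAlgCl p)), 𝒟.S = S ∧ (∀ g, (𝒟.residual g).val 1 0 = 0) ∧ (∃ ι : IsLocalRing.ResidueField (intermediateFieldIntegers p E) →+* IsLocalRing.ResidueField O, ∀ g (i : Fin 2), ι ((𝒟.residual g).val i i) = IsLocalRing.residue O ((ρ₀ g).val i i)) ∧ 𝒟.HasScalarCentralizer ∧ (∀ v : HeightOneSpectrum (𝓞 F), (p : 𝓞 F) ∈ v.asIdeal → 𝒟.IsDistinguishedAt v) ∧ (∀ v : HeightOneSpectrum (𝓞 F), (p : 𝓞 F) ∈ v.asIdeal → (𝒟.frame v).val 1 0 ≠ 0) ∧ 𝒟.IsDeformation (Algebra.ofId (intermediateFieldIntegers p E) (IsLocalRing.ResidueField (intermediateFieldIntegers p E))) ρE ∧ ∀ g, Matrix.GeneralLinearGroup.map ((algebraMap E (PadicAlgCl p)).comp (intermediateFieldIntegers p E).subtype) (ρE g) = T * ρ g * T⁻¹ :=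
  fun _ _ _ _ _ _ hO ρ ρ₀ hirr hint hloc S hS hSb => OrientedDatum.datum_exists hO ρ ρ₀ hirr hint hloc S hS hSb

end

end Summit.Langlands.Langlands.Cruxes.ReducibleOrdinaryProModular.SteinbergHyperplane
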